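import Summits.ResolutionOfSingularities.ResolutionOfSingularities.Theorems.WildQuotientsSummitReductionStubPairOrbitNormalFormBlowupChartsOverCentreElim
import Summits.ResolutionOfSingularities.ResolutionOfSingularities.Theorems.WildQuotientsSummitReductionStubPairOrbitNormalFormBlowupChartsOverCentreRsop
import HarnessLib

/-!
# `WildQuotients.SummitReduction` (stmt-ResolutionOfSingularities-16324), line `FramePerfect`, stub O3
# (`stub_pair_orbitNormalFormBlowup_chartsOverCentre`): the chart "`t₁ ≠ 0`" at its regular
# closed points over the closed point

Route `ResolutionOfSingularities/WildQuotients`, crux `SummitReduction`; helper file of stub O3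
(de Jong 1996, 4.27 [C2] on the coefficient-free model). For `R` regular local with a regular
system of parameters `(c, w)`, `c = (c₀, c₁, c₂, c₃)` the centre, `S ⊆ T` further branches among
the `w`, the strict transform of `c₀c₁ - c₂c₃ ∏_{k ∈ S} w_k` on the chart `R[𝔓/c₂]` is
`f = (c₀/c₂)(c₁/c₂) - (c₃/c₂) ∏_{k ∈ S} w_k` (de Jong 1996, p. 76: "`u'v' - t₂'t₃ ⋯ t_s = 0` …
`Z'` is given by `t₁t₂'t₃ ⋯ t_r = 0`"). At a CLOSED point `𝔔` of the chart over the closed point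
with at most one of the factors `c₃/c₂, w_k (k ∈ S)` in `𝔔`, or with `c₀/c₂` or `c₁/c₂`
invertible, the point is regular, and this file PROVES the marked families (a part of a regular
system of parameters of `R[𝔓/c₂]_𝔔` containing `f` and `c₂`, exponents `2` on `c₂`, `0` on
`f`, `≤ 1` elsewhere, a unit) exhibiting the boundary `c₂c₃ ∏_{k ∈ T} w_k` modulo `f`:

* `chartsOverCentre_chartT_uu` — `c₀/c₂, c₁/c₂ ∉ 𝔔` (all coordinates invertible, `S = ∅`):
  `chartsOverCentre_isRsopPart_cons_elim`;
* `chartsOverCentre_chartT_tu` — exactly one of them in `𝔔`: `f` replaces it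
(both in `𝔔`: `…ChartsOverCentreChartT2.lean`). Helpers: exchanging one member of a family
(`chartsOverCentre_span_range_update_eq`), the members and the marked monomial of the chart
family.

## Sources

* A. J. de Jong, *Smoothness, semi-stability and alterations*, Publ. Math. IHÉS 83 (1996), 4.27,
  p. 76. [DeJong1996]
* A. J. de Jong, *Families of curves and alterations*, Ann. Inst. Fourier 47 (1997), proof of
  Prop. 5.11, p. 619. [DeJong1997]
-/

set_option linter.dupNamespace false -- the tree's summit namespace repeats `ResolutionOfSingularities`

noncomputable section

open IsLocalRing
open Literature.AlgebraicGeometry.Resolution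

namespace Summit.ResolutionOfSingularities.ResolutionOfSingularities.Theorems

/-! ## Exchanging one member of a family -/

/-- **Exchanging one member**: replacing `z i` by `y` does not change the ideal generated by the
family as soon as `y` lies in it and `z i` lies in the ideal of the new family. [folklore] -/
theorem chartsOverCentre_span_range_update_eq {S : Type} [CommRing S] {N : ℕ} (z : Fin N → S)
    (i : Fin N) (y : S) (hy : y ∈ Ideal.span (Set.range z))
    (hz : z i ∈ Ideal.span (Set.range (Function.update z i y))) :
    Ideal.span (Set.range (Function.update z i y)) = Ideal.span (Set.range z) := by
  classical
  apply le_antisymm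
  · rw [Ideal.span_le]
    rintro _ ⟨j, rfl⟩
    by_cases h : j = i
    · subst h
      rw [Function.update_self]
      exact hy
    · rw [Function.update_of_ne h]
      exact Ideal.subset_span ⟨j, rfl⟩
  · rw [Ideal.span_le]
    rintro _ ⟨j, rfl⟩
    by_cases h : j = i
    · subst h
      exact hz
    · have : z j = Function.update z i y j := (Function.update_of_ne h y z).symm
      rw [this]
      exact Ideal.subset_span ⟨j, rfl⟩

/-- The members of the chart family: the exceptional generator first. [folklore] -/
theorem chartsOverCentre_chartFamily_zero {R A L : Type} [CommRing R] [CommRing A] [CommRing L]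
    [Algebra A L] {n : ℕ} (c : Fin n → R) (i : Fin n) {l : ℕ} (w : Fin l → R) (ψ : R →+* A)
    (u : Fin n → A) {a : ℕ} (jJ : Fin a → {j : Fin n // j ≠ i}) :
    chartFamily c i w L ψ u jJ 0 = algebraMap A L (ψ (c i)) := by simp [chartFamily]

/-- The members of the chart family: the enumerated chart generators. [folklore] -/
theorem chartsOverCentre_chartFamily_gen {R A L : Type} [CommRing R] [CommRing A] [CommRing L]
    [Algebra A L] {n : ℕ} (c : Fin n → R) (i : Fin n) {l : ℕ} (w : Fin l → R) (ψ : R →+* A)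
    (u : Fin n → A) {a : ℕ} (jJ : Fin a → {j : Fin n // j ≠ i}) (t : Fin a) :
    chartFamily c i w L ψ u jJ (Fin.castAdd l t).succ = algebraMap A L (u (jJ t).1) := by simp [chartFamily]

/-- The members of the chart family: the remaining parameters. [folklore] -/
theorem chartsOverCentre_chartFamily_w {R A L : Type} [CommRing R] [CommRing A] [CommRing L]
    [Algebra A L] {n : ℕ} (c : Fin n → R) (i : Fin n) {l : ℕ} (w : Fin l → R) (ψ : R →+* A)
    (u : Fin n → A) {a : ℕ} (jJ : Fin a → {j : Fin n // j ≠ i}) (k : Fin l) :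
    chartFamily c i w L ψ u jJ (Fin.natAdd a k).succ = algebraMap A L (ψ (w k)) := by simp [chartFamily]

/-- The product of the chart family raised to exponents `2` (exceptional generator), `ε`
(enumerated generators) and the indicator of `T` (remaining parameters). [folklore] -/
theorem chartsOverCentre_prod_chartFamily_pow {R A L : Type} [CommRing R] [CommRing A] [CommRing L]
    [Algebra A L] {n : ℕ} (c : Fin n → R) (i : Fin n) {l : ℕ} (w : Fin l → R) (ψ : R →+* A)
    (u : Fin n → A) {a : ℕ} (jJ : Fin a → {j : Fin n // j ≠ i}) (ε : Fin a → ℕ)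
    (T : Finset (Fin l)) [DecidablePred (· ∈ T)] :
    ∏ m, chartFamily c i w L ψ u jJ m ^
        (Fin.cons 2 (Fin.append ε fun k => if k ∈ T then 1 else 0) : Fin (a + l + 1) → ℕ) m =
      algebraMap A L (ψ (c i)) ^ 2 * (∏ t, algebraMap A L (u (jJ t).1) ^ ε t) *
        ∏ k ∈ T, algebraMap A L (ψ (w k)) := by
  classical
  have hQ : ∏ k, algebraMap A L (ψ (w k)) ^ (if k ∈ T then 1 else 0) = ∏ k ∈ T, algebraMap A L (ψ (w k)) := by
    rw [← Finset.prod_filter_of_ne (s := Finset.univ) (p := fun k => k ∈ T) (fun k _ hk => ?_)]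
    · rw [Finset.filter_mem_eq_inter, Finset.univ_inter]
      exact Finset.prod_congr rfl fun k hk => by rw [if_pos hk, pow_one]
    · by_contra hkT
      rw [if_neg hkT, pow_zero] at hk
      exact hk rfl
  rw [Fin.prod_univ_succ]
  simp only [chartFamily, Fin.cons_zero, Fin.cons_succ]
  rw [Fin.prod_univ_add]
  simp only [Fin.append_left, Fin.append_right]
  rw [show (∏ k, algebraMap A L (ψ (w k)) ^ (if k ∈ T then 1 else 0)) =
    ∏ k, algebraMap A L (ψ (w k)) ^ (if k ∈ T then 1 else 0) from
      Finset.prod_congr rfl fun k _ => by congr, hQ]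
  ring

/-- Replacing a member with exponent zero does not change the monomial. [folklore] -/
theorem chartsOverCentre_prod_update_pow {S : Type} [CommMonoid S] {N : ℕ} (z : Fin N → S) (i : Fin N)
    (y : S) (ex : Fin N → ℕ) (hi : ex i = 0) :
    ∏ m, Function.update z i y m ^ ex m = ∏ m, z m ^ ex m := by
  classical
  refine Finset.prod_congr rfl fun m _ => ?_
  by_cases h : m = i
  · subst h; rw [hi, pow_zero, pow_zero]
  · rw [Function.update_of_ne h]

/-- **Chart "`t₁ ≠ 0`", the points with `u/t₁` and `v/t₁` invertible** (then `t₂/t₁` is a unit and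
`s = 2`: the smooth quadric `u'v' = t₂'` of de Jong 1996, p. 76, at a point with all coordinates
invertible): the strict transform `f = (c₀/c₂)(c₁/c₂) - (c₃/c₂)` is, by
`chartsOverCentre_isRsopPart_cons_elim`, the first member of the part `(f, c₂, w)` of a regular
system of parameters, and the boundary `c₂c₃ ∏_{k ∈ T} w_k = (c₃/c₂) · c₂² ∏ w_k` is a unit times a
monomial in it. [cite: DeJong1996, 4.27, p. 76] -/
theorem chartsOverCentre_chartT_uu {R : Type} [CommRing R] [IsRegularLocalRing R]
    (c : Fin 4 → R) {l : ℕ} (w : Fin l → R)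
    (hz : Ideal.span (Set.range (Fin.append c w)) = maximalIdeal R)
    (hd : (maximalIdeal R).spanFinrank = 4 + l)
    (𝔓 : Ideal R) (h𝔓 : 𝔓 = Ideal.span (Set.range c)) (hc : ∀ k, c k ∈ 𝔓)
    (S T : Finset (Fin l))
    (𝔔 : Ideal (blowupAlgebra 𝔓 (c 2))) [𝔔.IsMaximal]
    (h𝔔 : 𝔔.comap (algebraMap R _) = maximalIdeal R)
    (L : Type) [CommRing L] [IsLocalRing L] [Algebra (blowupAlgebra 𝔓 (c 2)) L]
    [IsLocalization.AtPrime L 𝔔]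
    (hf : blowupAlgebra.gen 𝔓 (c 2) (c 0) (hc 0) * blowupAlgebra.gen 𝔓 (c 2) (c 1) (hc 1) - blowupAlgebra.gen 𝔓 (c 2) (c 2) (hc 2) * blowupAlgebra.gen 𝔓 (c 2) (c 3) (hc 3) * algebraMap R (blowupAlgebra 𝔓 (c 2)) (∏ k ∈ S, w k) ∈ 𝔔)
    (h0 : blowupAlgebra.gen 𝔓 (c 2) (c 0) (hc 0) ∉ 𝔔) (h1 : blowupAlgebra.gen 𝔓 (c 2) (c 1) (hc 1) ∉ 𝔔) :
    ∃ (N : ℕ) (Z : Fin N → L) (i_f i₀ : Fin N) (ex : Fin N → ℕ) (U : L),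
      i_f ≠ i₀ ∧ IsRsopPart Z ∧ Z i_f = algebraMap (blowupAlgebra 𝔓 (c 2)) L (blowupAlgebra.gen 𝔓 (c 2) (c 0) (hc 0) * blowupAlgebra.gen 𝔓 (c 2) (c 1) (hc 1) - blowupAlgebra.gen 𝔓 (c 2) (c 2) (hc 2) * blowupAlgebra.gen 𝔓 (c 2) (c 3) (hc 3) * algebraMap R (blowupAlgebra 𝔓 (c 2)) (∏ k ∈ S, w k)) ∧ Z i₀ = algebraMap (blowupAlgebra 𝔓 (c 2)) L (algebraMap R (blowupAlgebra 𝔓 (c 2)) (c 2)) ∧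
      ex i₀ = 2 ∧ ex i_f = 0 ∧ (∀ i, i ≠ i₀ → ex i ≤ 1) ∧ IsUnit U ∧
      algebraMap (blowupAlgebra 𝔓 (c 2)) L (algebraMap R (blowupAlgebra 𝔓 (c 2)) (c 2 * c 3 * ∏ k ∈ T, w k)) - U * ∏ i, Z i ^ ex i ∈ Ideal.span {algebraMap (blowupAlgebra 𝔓 (c 2)) L (blowupAlgebra.gen 𝔓 (c 2) (c 0) (hc 0) * blowupAlgebra.gen 𝔓 (c 2) (c 1) (hc 1) - blowupAlgebra.gen 𝔓 (c 2) (c 2) (hc 2) * blowupAlgebra.gen 𝔓 (c 2) (c 3) (hc 3) * algebraMap R (blowupAlgebra 𝔓 (c 2)) (∏ k ∈ S, w k))} := by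
  classical
  have he2 : blowupAlgebra.gen 𝔓 (c 2) (c 2) (hc 2) = 1 := blowupAlgebra.gen_self 𝔓 (c 2) (hc 2)
  have hcm : ∀ m, algebraMap R (blowupAlgebra 𝔓 (c 2)) (c m) = blowupAlgebra.gen 𝔓 (c 2) (c m) (hc m) * algebraMap R (blowupAlgebra 𝔓 (c 2)) (c 2) := fun m =>
    (blowupAlgebra.gen_mul_algebraMap 𝔓 (c 2) (c m) (hc m)).symm
  have hwk : ∀ k, algebraMap R (blowupAlgebra 𝔓 (c 2)) (w k) ∈ 𝔔 := fun k => map_w_mem c w hz (algebraMap R (blowupAlgebra 𝔓 (c 2))) 𝔔 h𝔔 k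
  have hunit : ∀ m, blowupAlgebra.gen 𝔓 (c 2) (c m) (hc m) ∉ 𝔔 →
      IsUnit (algebraMap (blowupAlgebra 𝔓 (c 2)) L (blowupAlgebra.gen 𝔓 (c 2) (c m) (hc m))) := fun m hm =>
    IsLocalization.map_units L (⟨blowupAlgebra.gen 𝔓 (c 2) (c m) (hc m), hm⟩ : 𝔔.primeCompl)
  -- `c₃/c₂` is a unit and `S = ∅`
  have h3H : blowupAlgebra.gen 𝔓 (c 2) (c 3) (hc 3) * algebraMap R (blowupAlgebra 𝔓 (c 2)) (∏ k ∈ S, w k) ∉ 𝔔 := by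
    intro h
    have : blowupAlgebra.gen 𝔓 (c 2) (c 0) (hc 0) * blowupAlgebra.gen 𝔓 (c 2) (c 1) (hc 1) ∈ 𝔔 := by
      have := 𝔔.add_mem hf h
      rwa [he2, one_mul, sub_add_cancel] at this
    rcases Ideal.IsPrime.mem_or_mem inferInstance this with h' | h'
    · exact h0 h'
    · exact h1 h'
  have h3 : blowupAlgebra.gen 𝔓 (c 2) (c 3) (hc 3) ∉ 𝔔 := fun h => h3H (𝔔.mul_mem_right _ h)
  have hS : S = ∅ := by
    by_contra hne
    obtain ⟨k, hk⟩ := Finset.nonempty_iff_ne_empty.mpr hne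
    apply h3H
    obtain ⟨q, hq⟩ : w k ∣ (∏ k ∈ S, w k) := Finset.dvd_prod_of_mem _ hk
    have : blowupAlgebra.gen 𝔓 (c 2) (c 3) (hc 3) * algebraMap R (blowupAlgebra 𝔓 (c 2)) (∏ k ∈ S, w k) = algebraMap R (blowupAlgebra 𝔓 (c 2)) (w k) * (blowupAlgebra.gen 𝔓 (c 2) (c 3) (hc 3) * algebraMap R (blowupAlgebra 𝔓 (c 2)) q) := by rw [hq, map_mul]; ring
    rw [this]
    exact 𝔔.mul_mem_right _ (hwk k)
  have hH1 : algebraMap R (blowupAlgebra 𝔓 (c 2)) (∏ k ∈ S, w k) = 1 := by rw [hS, Finset.prod_empty, map_one]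
  have hfeq : blowupAlgebra.gen 𝔓 (c 2) (c 0) (hc 0) * blowupAlgebra.gen 𝔓 (c 2) (c 1) (hc 1) - blowupAlgebra.gen 𝔓 (c 2) (c 2) (hc 2) * blowupAlgebra.gen 𝔓 (c 2) (c 3) (hc 3) * algebraMap R (blowupAlgebra 𝔓 (c 2)) (∏ k ∈ S, w k) = -(blowupAlgebra.gen 𝔓 (c 2) (c 3) (hc 3) - blowupAlgebra.gen 𝔓 (c 2) (c 0) (hc 0) * blowupAlgebra.gen 𝔓 (c 2) (c 1) (hc 1)) := by rw [he2, hH1]; ring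
  have hf' : blowupAlgebra.gen 𝔓 (c 2) (c 3) (hc 3) - blowupAlgebra.gen 𝔓 (c 2) (c 0) (hc 0) * blowupAlgebra.gen 𝔓 (c 2) (c 1) (hc 1) ∈ 𝔔 := by
    have := 𝔔.neg_mem hf
    rwa [hfeq, neg_neg] at this
  have hrs := chartsOverCentre_isRsopPart_cons_elim c 2 w hz hd 𝔓 h𝔓 hc 𝔔 h𝔔 L
    ⟨3, by decide⟩ ⟨0, by decide⟩ ⟨1, by decide⟩ (by decide) (by decide) hf'
  -- replace `-f` by `f`
  have hspan : Ideal.span (Set.range (Fin.cons (algebraMap (blowupAlgebra 𝔓 (c 2)) L (blowupAlgebra.gen 𝔓 (c 2) (c 0) (hc 0) * blowupAlgebra.gen 𝔓 (c 2) (c 1) (hc 1) - blowupAlgebra.gen 𝔓 (c 2) (c 2) (hc 2) * blowupAlgebra.gen 𝔓 (c 2) (c 3) (hc 3) * algebraMap R (blowupAlgebra 𝔓 (c 2)) (∏ k ∈ S, w k)))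
      (chartFamily c 2 w L (algebraMap R (blowupAlgebra 𝔓 (c 2))) (fun k => blowupAlgebra.gen 𝔓 (c 2) (c k) (hc k)) Fin.elim0) :
        Fin (0 + l + 1 + 1) → L)) =
      Ideal.span (Set.range (Fin.cons (algebraMap (blowupAlgebra 𝔓 (c 2)) L (blowupAlgebra.gen 𝔓 (c 2) (c 3) (hc 3) - blowupAlgebra.gen 𝔓 (c 2) (c 0) (hc 0) * blowupAlgebra.gen 𝔓 (c 2) (c 1) (hc 1)))
      (chartFamily c 2 w L (algebraMap R (blowupAlgebra 𝔓 (c 2))) (fun k => blowupAlgebra.gen 𝔓 (c 2) (c k) (hc k)) Fin.elim0) :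
        Fin (0 + l + 1 + 1) → L)) := by
    rw [Fin.range_cons, Fin.range_cons, Ideal.span_insert, Ideal.span_insert, hfeq, map_neg,
      Ideal.span_singleton_neg]
  refine ⟨0 + l + 1 + 1, Fin.cons (algebraMap (blowupAlgebra 𝔓 (c 2)) L (blowupAlgebra.gen 𝔓 (c 2) (c 0) (hc 0) * blowupAlgebra.gen 𝔓 (c 2) (c 1) (hc 1) - blowupAlgebra.gen 𝔓 (c 2) (c 2) (hc 2) * blowupAlgebra.gen 𝔓 (c 2) (c 3) (hc 3) * algebraMap R (blowupAlgebra 𝔓 (c 2)) (∏ k ∈ S, w k)))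
      (chartFamily c 2 w L (algebraMap R (blowupAlgebra 𝔓 (c 2))) (fun k => blowupAlgebra.gen 𝔓 (c 2) (c k) (hc k)) Fin.elim0),
    0, (0 : Fin (0 + l + 1)).succ,
    Fin.cons 0 (Fin.cons 2 (Fin.append Fin.elim0 fun k => if k ∈ T then 1 else 0)),
    algebraMap (blowupAlgebra 𝔓 (c 2)) L (blowupAlgebra.gen 𝔓 (c 2) (c 3) (hc 3)), (Fin.succ_ne_zero _).symm, chartsOverCentre_isRsopPart_of_span_eq hrs hspan,
    rfl, ?_, rfl, rfl, fun i hi => ?_, hunit 3 h3, ?_⟩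
  · rw [Fin.cons_succ, chartsOverCentre_chartFamily_zero]
  · induction i using Fin.cases with
    | zero => simp
    | succ i =>
      rw [Fin.cons_succ]
      induction i using Fin.cases with
      | zero => exact absurd rfl hi
      | succ i =>
        rw [Fin.cons_succ]
        refine Fin.addCases (fun t => Fin.elim0 t) (fun k => ?_) i
        rw [Fin.append_right]
        split_ifs <;> omega
  · rw [Fin.prod_univ_succ, Fin.cons_zero, Fin.cons_zero, pow_zero, one_mul]
    simp only [Fin.cons_succ]
    rw [chartsOverCentre_prod_chartFamily_pow]
    simp only [Finset.univ_eq_empty, Finset.prod_empty, mul_one, map_mul, map_prod]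
    rw [hcm 3, map_mul]
    rw [show algebraMap (blowupAlgebra 𝔓 (c 2)) L (algebraMap R (blowupAlgebra 𝔓 (c 2)) (c 2)) * (algebraMap (blowupAlgebra 𝔓 (c 2)) L (blowupAlgebra.gen 𝔓 (c 2) (c 3) (hc 3)) * algebraMap (blowupAlgebra 𝔓 (c 2)) L (algebraMap R (blowupAlgebra 𝔓 (c 2)) (c 2))) * ∏ k ∈ T, algebraMap (blowupAlgebra 𝔓 (c 2)) L (algebraMap R (blowupAlgebra 𝔓 (c 2)) (w k)) -
      algebraMap (blowupAlgebra 𝔓 (c 2)) L (blowupAlgebra.gen 𝔓 (c 2) (c 3) (hc 3)) * (algebraMap (blowupAlgebra 𝔓 (c 2)) L (algebraMap R (blowupAlgebra 𝔓 (c 2)) (c 2)) ^ 2 * ∏ k ∈ T, algebraMap (blowupAlgebra 𝔓 (c 2)) L (algebraMap R (blowupAlgebra 𝔓 (c 2)) (w k))) = 0 by ring]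
    exact Ideal.zero_mem _

/-- **Chart "`t₁ ≠ 0`", the points with exactly one of `u/t₁`, `v/t₁` invertible**: with
`c_p/c₂ ∈ 𝔔` and `c_q/c₂ ∉ 𝔔` (`{p, q} = {0, 1}`), the strict transform
`f = (c₀/c₂)(c₁/c₂) - (c₃/c₂) ∏_{k ∈ S} w_k` may replace `c_p/c₂` in the chart family
(`f ≡ (c_q/c₂) · (c_p/c₂)` modulo `c₃/c₂` if `c₃/c₂ ∈ 𝔔`, resp. modulo the `w_k`, `k ∈ S ≠ ∅`,
if not), and the boundary `c₂c₃ ∏_{k ∈ T} w_k = c₂² (c₃/c₂) ∏ w_k` is a unit times a monomial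
in the resulting part of a regular system of parameters (de Jong 1996, p. 76: on the chart
"`t₁ ≠ 0`" … "`Z'` is given by `t₁t₂'t₃ ⋯ t_r = 0`", here at a regular point off the double
locus). [cite: DeJong1996, 4.27, p. 76] -/
theorem chartsOverCentre_chartT_tu {R : Type} [CommRing R] [IsRegularLocalRing R]
    (c : Fin 4 → R) {l : ℕ} (w : Fin l → R)
    (hz : Ideal.span (Set.range (Fin.append c w)) = maximalIdeal R)
    (hd : (maximalIdeal R).spanFinrank = 4 + l)
    (𝔓 : Ideal R) (h𝔓 : 𝔓 = Ideal.span (Set.range c)) (hc : ∀ k, c k ∈ 𝔓)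
    (S T : Finset (Fin l))
    (𝔔 : Ideal (blowupAlgebra 𝔓 (c 2))) [𝔔.IsMaximal]
    (h𝔔 : 𝔔.comap (algebraMap R _) = maximalIdeal R)
    (L : Type) [CommRing L] [IsLocalRing L] [Algebra (blowupAlgebra 𝔓 (c 2)) L]
    [IsLocalization.AtPrime L 𝔔]
    (hf : blowupAlgebra.gen 𝔓 (c 2) (c 0) (hc 0) * blowupAlgebra.gen 𝔓 (c 2) (c 1) (hc 1) - blowupAlgebra.gen 𝔓 (c 2) (c 2) (hc 2) * blowupAlgebra.gen 𝔓 (c 2) (c 3) (hc 3) * algebraMap R (blowupAlgebra 𝔓 (c 2)) (∏ k ∈ S, w k) ∈ 𝔔)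
    (p q : {k : Fin 4 // k ≠ 2}) (hp3 : p ≠ ⟨3, by decide⟩)
    (hepq : blowupAlgebra.gen 𝔓 (c 2) (c p.1) (hc _) * blowupAlgebra.gen 𝔓 (c 2) (c q.1) (hc _) =
      blowupAlgebra.gen 𝔓 (c 2) (c 0) (hc 0) * blowupAlgebra.gen 𝔓 (c 2) (c 1) (hc 1))
    (hp : blowupAlgebra.gen 𝔓 (c 2) (c p.1) (hc _) ∈ 𝔔)
    (hq : blowupAlgebra.gen 𝔓 (c 2) (c q.1) (hc _) ∉ 𝔔) :
    ∃ (N : ℕ) (Z : Fin N → L) (i_f i₀ : Fin N) (ex : Fin N → ℕ) (U : L),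
      i_f ≠ i₀ ∧ IsRsopPart Z ∧ Z i_f = algebraMap (blowupAlgebra 𝔓 (c 2)) L (blowupAlgebra.gen 𝔓 (c 2) (c 0) (hc 0) * blowupAlgebra.gen 𝔓 (c 2) (c 1) (hc 1) - blowupAlgebra.gen 𝔓 (c 2) (c 2) (hc 2) * blowupAlgebra.gen 𝔓 (c 2) (c 3) (hc 3) * algebraMap R (blowupAlgebra 𝔓 (c 2)) (∏ k ∈ S, w k)) ∧ Z i₀ = algebraMap (blowupAlgebra 𝔓 (c 2)) L (algebraMap R (blowupAlgebra 𝔓 (c 2)) (c 2)) ∧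
      ex i₀ = 2 ∧ ex i_f = 0 ∧ (∀ i, i ≠ i₀ → ex i ≤ 1) ∧ IsUnit U ∧
      algebraMap (blowupAlgebra 𝔓 (c 2)) L (algebraMap R (blowupAlgebra 𝔓 (c 2)) (c 2 * c 3 * ∏ k ∈ T, w k)) - U * ∏ i, Z i ^ ex i ∈ Ideal.span {algebraMap (blowupAlgebra 𝔓 (c 2)) L (blowupAlgebra.gen 𝔓 (c 2) (c 0) (hc 0) * blowupAlgebra.gen 𝔓 (c 2) (c 1) (hc 1) - blowupAlgebra.gen 𝔓 (c 2) (c 2) (hc 2) * blowupAlgebra.gen 𝔓 (c 2) (c 3) (hc 3) * algebraMap R (blowupAlgebra 𝔓 (c 2)) (∏ k ∈ S, w k))} := by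
  classical
  have he2 : blowupAlgebra.gen 𝔓 (c 2) (c 2) (hc 2) = 1 := blowupAlgebra.gen_self 𝔓 (c 2) (hc 2)
  have hcm : ∀ m, algebraMap R (blowupAlgebra 𝔓 (c 2)) (c m) = blowupAlgebra.gen 𝔓 (c 2) (c m) (hc m) * algebraMap R (blowupAlgebra 𝔓 (c 2)) (c 2) := fun m =>
    (blowupAlgebra.gen_mul_algebraMap 𝔓 (c 2) (c m) (hc m)).symm
  have hwk : ∀ k, algebraMap R (blowupAlgebra 𝔓 (c 2)) (w k) ∈ 𝔔 := fun k => map_w_mem c w hz (algebraMap R (blowupAlgebra 𝔓 (c 2))) 𝔔 h𝔔 k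
  have hunit : ∀ m, blowupAlgebra.gen 𝔓 (c 2) (c m) (hc m) ∉ 𝔔 →
      IsUnit (algebraMap (blowupAlgebra 𝔓 (c 2)) L (blowupAlgebra.gen 𝔓 (c 2) (c m) (hc m))) := fun m hm =>
    IsLocalization.map_units L (⟨blowupAlgebra.gen 𝔓 (c 2) (c m) (hc m), hm⟩ : 𝔔.primeCompl)
  have hfeq : blowupAlgebra.gen 𝔓 (c 2) (c 0) (hc 0) * blowupAlgebra.gen 𝔓 (c 2) (c 1) (hc 1) - blowupAlgebra.gen 𝔓 (c 2) (c 2) (hc 2) * blowupAlgebra.gen 𝔓 (c 2) (c 3) (hc 3) * algebraMap R (blowupAlgebra 𝔓 (c 2)) (∏ k ∈ S, w k) = blowupAlgebra.gen 𝔓 (c 2) (c p.1) (hc _) * blowupAlgebra.gen 𝔓 (c 2) (c q.1) (hc _) -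
      blowupAlgebra.gen 𝔓 (c 2) (c 3) (hc 3) * algebraMap R (blowupAlgebra 𝔓 (c 2)) (∏ k ∈ S, w k) := by rw [he2, one_mul, hepq]
  obtain ⟨v, hv⟩ := (hunit q.1 hq).exists_left_inv
  have hbdry : algebraMap (blowupAlgebra 𝔓 (c 2)) L (algebraMap R (blowupAlgebra 𝔓 (c 2)) (c 2 * c 3 * ∏ k ∈ T, w k)) =
      algebraMap (blowupAlgebra 𝔓 (c 2)) L (algebraMap R (blowupAlgebra 𝔓 (c 2)) (c 2)) ^ 2 * algebraMap (blowupAlgebra 𝔓 (c 2)) L (blowupAlgebra.gen 𝔓 (c 2) (c 3) (hc 3)) * ∏ k ∈ T, algebraMap (blowupAlgebra 𝔓 (c 2)) L (algebraMap R (blowupAlgebra 𝔓 (c 2)) (w k)) := by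
    simp only [map_mul, map_prod]
    rw [hcm 3, map_mul]
    ring
  by_cases h3 : blowupAlgebra.gen 𝔓 (c 2) (c 3) (hc 3) ∈ 𝔔
  · -- `c₃/c₂ ∈ 𝔔`: replace `c_p/c₂` in `(c₂, c_p/c₂, c₃/c₂, w)`
    let jJ : Fin 2 → {k : Fin 4 // k ≠ 2} := ![p, ⟨3, by decide⟩]
    have hjJinj : Function.Injective jJ := by
      intro s s' h
      fin_cases s <;> fin_cases s'
      · rfl
      · exact absurd h hp3
      · exact absurd h.symm hp3
      · rfl
    have hjJ𝔔 : ∀ t, blowupAlgebra.gen 𝔓 (c 2) (c (jJ t).1) (hc _) ∈ 𝔔 := by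
      intro t
      fin_cases t
      · exact hp
      · exact h3
    have hrs := chartsOverCentre_isRsopPart_chartFamily c 2 w hz hd 𝔓 h𝔓 hc 𝔔 h𝔔 L jJ hjJinj hjJ𝔔
    set z := chartFamily c 2 w L (algebraMap R (blowupAlgebra 𝔓 (c 2))) (fun k => blowupAlgebra.gen 𝔓 (c 2) (c k) (hc k)) jJ with hzdef
    have hz0 : z 0 = algebraMap (blowupAlgebra 𝔓 (c 2)) L (algebraMap R (blowupAlgebra 𝔓 (c 2)) (c 2)) := chartsOverCentre_chartFamily_zero c 2 w (algebraMap R (blowupAlgebra 𝔓 (c 2))) _ jJ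
    have hzp : z (Fin.castAdd l 0).succ = algebraMap (blowupAlgebra 𝔓 (c 2)) L (blowupAlgebra.gen 𝔓 (c 2) (c p.1) (hc _)) :=
      chartsOverCentre_chartFamily_gen c 2 w (algebraMap R (blowupAlgebra 𝔓 (c 2))) _ jJ 0
    have hz3 : z (Fin.castAdd l 1).succ = algebraMap (blowupAlgebra 𝔓 (c 2)) L (blowupAlgebra.gen 𝔓 (c 2) (c 3) (hc 3)) :=
      chartsOverCentre_chartFamily_gen c 2 w (algebraMap R (blowupAlgebra 𝔓 (c 2))) _ jJ 1
    have hne : (Fin.castAdd l (1 : Fin 2)).succ ≠ (Fin.castAdd l (0 : Fin 2)).succ := by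
      intro h
      have := Fin.castAdd_injective _ _ (Fin.succ_injective _ h)
      exact absurd this (by decide)
    have hy : algebraMap (blowupAlgebra 𝔓 (c 2)) L (blowupAlgebra.gen 𝔓 (c 2) (c 0) (hc 0) * blowupAlgebra.gen 𝔓 (c 2) (c 1) (hc 1) - blowupAlgebra.gen 𝔓 (c 2) (c 2) (hc 2) * blowupAlgebra.gen 𝔓 (c 2) (c 3) (hc 3) * algebraMap R (blowupAlgebra 𝔓 (c 2)) (∏ k ∈ S, w k)) ∈ Ideal.span (Set.range z) := by
      rw [hfeq, map_sub, map_mul, map_mul, ← hzp, ← hz3]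
      exact Ideal.sub_mem _ (Ideal.mul_mem_right _ _ (Ideal.subset_span ⟨_, rfl⟩))
        (Ideal.mul_mem_right _ _ (Ideal.subset_span ⟨_, rfl⟩))
    have hzmem : z (Fin.castAdd l 0).succ ∈
        Ideal.span (Set.range (Function.update z (Fin.castAdd l 0).succ (algebraMap (blowupAlgebra 𝔓 (c 2)) L (blowupAlgebra.gen 𝔓 (c 2) (c 0) (hc 0) * blowupAlgebra.gen 𝔓 (c 2) (c 1) (hc 1) - blowupAlgebra.gen 𝔓 (c 2) (c 2) (hc 2) * blowupAlgebra.gen 𝔓 (c 2) (c 3) (hc 3) * algebraMap R (blowupAlgebra 𝔓 (c 2)) (∏ k ∈ S, w k))))) := by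
      have key : z (Fin.castAdd l 0).succ = v * (Function.update z (Fin.castAdd l 0).succ (algebraMap (blowupAlgebra 𝔓 (c 2)) L (blowupAlgebra.gen 𝔓 (c 2) (c 0) (hc 0) * blowupAlgebra.gen 𝔓 (c 2) (c 1) (hc 1) - blowupAlgebra.gen 𝔓 (c 2) (c 2) (hc 2) * blowupAlgebra.gen 𝔓 (c 2) (c 3) (hc 3) * algebraMap R (blowupAlgebra 𝔓 (c 2)) (∏ k ∈ S, w k)))
          (Fin.castAdd l 0).succ + Function.update z (Fin.castAdd l 0).succ (algebraMap (blowupAlgebra 𝔓 (c 2)) L (blowupAlgebra.gen 𝔓 (c 2) (c 0) (hc 0) * blowupAlgebra.gen 𝔓 (c 2) (c 1) (hc 1) - blowupAlgebra.gen 𝔓 (c 2) (c 2) (hc 2) * blowupAlgebra.gen 𝔓 (c 2) (c 3) (hc 3) * algebraMap R (blowupAlgebra 𝔓 (c 2)) (∏ k ∈ S, w k)))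
          (Fin.castAdd l 1).succ * algebraMap (blowupAlgebra 𝔓 (c 2)) L (algebraMap R (blowupAlgebra 𝔓 (c 2)) (∏ k ∈ S, w k))) := by
        rw [Function.update_self, Function.update_of_ne hne, hz3, hzp, hfeq, map_sub, map_mul, map_mul]
        calc algebraMap (blowupAlgebra 𝔓 (c 2)) L (blowupAlgebra.gen 𝔓 (c 2) (c p.1) (hc _))
            = (v * algebraMap (blowupAlgebra 𝔓 (c 2)) L (blowupAlgebra.gen 𝔓 (c 2) (c q.1) (hc _))) *
                algebraMap (blowupAlgebra 𝔓 (c 2)) L (blowupAlgebra.gen 𝔓 (c 2) (c p.1) (hc _)) := by rw [hv, one_mul]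
          _ = _ := by ring
      rw [key]
      exact Ideal.mul_mem_left _ _ (Ideal.add_mem _ (Ideal.subset_span ⟨_, rfl⟩)
        (Ideal.mul_mem_right _ _ (Ideal.subset_span ⟨_, rfl⟩)))
    have hspan := chartsOverCentre_span_range_update_eq z _ _ hy hzmem
    refine ⟨2 + l + 1, Function.update z (Fin.castAdd l 0).succ (algebraMap (blowupAlgebra 𝔓 (c 2)) L (blowupAlgebra.gen 𝔓 (c 2) (c 0) (hc 0) * blowupAlgebra.gen 𝔓 (c 2) (c 1) (hc 1) - blowupAlgebra.gen 𝔓 (c 2) (c 2) (hc 2) * blowupAlgebra.gen 𝔓 (c 2) (c 3) (hc 3) * algebraMap R (blowupAlgebra 𝔓 (c 2)) (∏ k ∈ S, w k))), (Fin.castAdd l 0).succ, 0,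
      Fin.cons 2 (Fin.append ![0, 1] fun k => if k ∈ T then 1 else 0), 1, Fin.succ_ne_zero _,
      chartsOverCentre_isRsopPart_of_span_eq hrs hspan, Function.update_self _ _ _, ?_, rfl, ?_,
      fun i hi => ?_, isUnit_one, ?_⟩
    · rw [Function.update_of_ne (Fin.succ_ne_zero _).symm, hz0]
    · rw [Fin.cons_succ, Fin.append_left]
      rfl
    · obtain ⟨i, rfl⟩ := Fin.exists_succ_eq.mpr hi
      rw [Fin.cons_succ]
      refine Fin.addCases (fun t => ?_) (fun k => ?_) i
      · rw [Fin.append_left]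
        fin_cases t <;> simp
      · rw [Fin.append_right]
        split_ifs <;> omega
    · rw [chartsOverCentre_prod_update_pow _ _ _ _ (by rw [Fin.cons_succ, Fin.append_left]; rfl), hzdef,
        chartsOverCentre_prod_chartFamily_pow, hbdry, Fin.prod_univ_two]
      simp only [jJ, Matrix.cons_val_zero, Matrix.cons_val_one, pow_zero, pow_one, one_mul]
      rw [sub_self]
      exact Ideal.zero_mem _
  · -- `c₃/c₂ ∉ 𝔔`: then `S ≠ ∅`; replace `c_p/c₂` in `(c₂, c_p/c₂, w)`
    have hS : S.Nonempty := by
      rw [Finset.nonempty_iff_ne_empty]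
      intro hS
      apply h3
      have hH1 : algebraMap R (blowupAlgebra 𝔓 (c 2)) (∏ k ∈ S, w k) = 1 := by rw [hS, Finset.prod_empty, map_one]
      have h1 : blowupAlgebra.gen 𝔓 (c 2) (c p.1) (hc _) * blowupAlgebra.gen 𝔓 (c 2) (c q.1) (hc _) ∈ 𝔔 :=
        𝔔.mul_mem_right _ hp
      have := 𝔔.sub_mem h1 hf
      rwa [hfeq, hH1, mul_one, sub_sub_cancel] at this
    obtain ⟨k₀, hk₀⟩ := hS
    obtain ⟨H', hH'⟩ : w k₀ ∣ (∏ k ∈ S, w k) := Finset.dvd_prod_of_mem _ hk₀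
    let jJ : Fin 1 → {k : Fin 4 // k ≠ 2} := ![p]
    have hjJinj : Function.Injective jJ := Function.injective_of_subsingleton _
    have hjJ𝔔 : ∀ t, blowupAlgebra.gen 𝔓 (c 2) (c (jJ t).1) (hc _) ∈ 𝔔 := by
      intro t
      fin_cases t
      exact hp
    have hrs := chartsOverCentre_isRsopPart_chartFamily c 2 w hz hd 𝔓 h𝔓 hc 𝔔 h𝔔 L jJ hjJinj hjJ𝔔
    set z := chartFamily c 2 w L (algebraMap R (blowupAlgebra 𝔓 (c 2))) (fun k => blowupAlgebra.gen 𝔓 (c 2) (c k) (hc k)) jJ with hzdef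
    have hz0 : z 0 = algebraMap (blowupAlgebra 𝔓 (c 2)) L (algebraMap R (blowupAlgebra 𝔓 (c 2)) (c 2)) := chartsOverCentre_chartFamily_zero c 2 w (algebraMap R (blowupAlgebra 𝔓 (c 2))) _ jJ
    have hzp : z (Fin.castAdd l 0).succ = algebraMap (blowupAlgebra 𝔓 (c 2)) L (blowupAlgebra.gen 𝔓 (c 2) (c p.1) (hc _)) :=
      chartsOverCentre_chartFamily_gen c 2 w (algebraMap R (blowupAlgebra 𝔓 (c 2))) _ jJ 0
    have hzw : z (Fin.natAdd 1 k₀).succ = algebraMap (blowupAlgebra 𝔓 (c 2)) L (algebraMap R (blowupAlgebra 𝔓 (c 2)) (w k₀)) :=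
      chartsOverCentre_chartFamily_w c 2 w (algebraMap R (blowupAlgebra 𝔓 (c 2))) _ jJ k₀
    have hne : (Fin.natAdd 1 k₀).succ ≠ (Fin.castAdd l (0 : Fin 1)).succ := by
      intro h
      have := congrArg Fin.val (Fin.succ_injective _ h)
      simp at this
    have hH : algebraMap (blowupAlgebra 𝔓 (c 2)) L (algebraMap R (blowupAlgebra 𝔓 (c 2)) (∏ k ∈ S, w k)) = z (Fin.natAdd 1 k₀).succ * algebraMap (blowupAlgebra 𝔓 (c 2)) L (algebraMap R (blowupAlgebra 𝔓 (c 2)) H') := by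
      rw [hzw, hH', map_mul, map_mul]
    have hy : algebraMap (blowupAlgebra 𝔓 (c 2)) L (blowupAlgebra.gen 𝔓 (c 2) (c 0) (hc 0) * blowupAlgebra.gen 𝔓 (c 2) (c 1) (hc 1) - blowupAlgebra.gen 𝔓 (c 2) (c 2) (hc 2) * blowupAlgebra.gen 𝔓 (c 2) (c 3) (hc 3) * algebraMap R (blowupAlgebra 𝔓 (c 2)) (∏ k ∈ S, w k)) ∈ Ideal.span (Set.range z) := by
      rw [hfeq, map_sub, map_mul, map_mul, ← hzp, hH]
      refine Ideal.sub_mem _ (Ideal.mul_mem_right _ _ (Ideal.subset_span ⟨_, rfl⟩))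
        (Ideal.mul_mem_left _ _ (Ideal.mul_mem_right _ _ (Ideal.subset_span ⟨_, rfl⟩)))
    have hzmem : z (Fin.castAdd l 0).succ ∈
        Ideal.span (Set.range (Function.update z (Fin.castAdd l 0).succ (algebraMap (blowupAlgebra 𝔓 (c 2)) L (blowupAlgebra.gen 𝔓 (c 2) (c 0) (hc 0) * blowupAlgebra.gen 𝔓 (c 2) (c 1) (hc 1) - blowupAlgebra.gen 𝔓 (c 2) (c 2) (hc 2) * blowupAlgebra.gen 𝔓 (c 2) (c 3) (hc 3) * algebraMap R (blowupAlgebra 𝔓 (c 2)) (∏ k ∈ S, w k))))) := by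
      have key : z (Fin.castAdd l 0).succ = v * (Function.update z (Fin.castAdd l 0).succ (algebraMap (blowupAlgebra 𝔓 (c 2)) L (blowupAlgebra.gen 𝔓 (c 2) (c 0) (hc 0) * blowupAlgebra.gen 𝔓 (c 2) (c 1) (hc 1) - blowupAlgebra.gen 𝔓 (c 2) (c 2) (hc 2) * blowupAlgebra.gen 𝔓 (c 2) (c 3) (hc 3) * algebraMap R (blowupAlgebra 𝔓 (c 2)) (∏ k ∈ S, w k)))
          (Fin.castAdd l 0).succ + algebraMap (blowupAlgebra 𝔓 (c 2)) L (blowupAlgebra.gen 𝔓 (c 2) (c 3) (hc 3)) * (Function.update z (Fin.castAdd l 0).succ (algebraMap (blowupAlgebra 𝔓 (c 2)) L (blowupAlgebra.gen 𝔓 (c 2) (c 0) (hc 0) * blowupAlgebra.gen 𝔓 (c 2) (c 1) (hc 1) - blowupAlgebra.gen 𝔓 (c 2) (c 2) (hc 2) * blowupAlgebra.gen 𝔓 (c 2) (c 3) (hc 3) * algebraMap R (blowupAlgebra 𝔓 (c 2)) (∏ k ∈ S, w k)))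
          (Fin.natAdd 1 k₀).succ * algebraMap (blowupAlgebra 𝔓 (c 2)) L (algebraMap R (blowupAlgebra 𝔓 (c 2)) H'))) := by
        rw [Function.update_self, Function.update_of_ne hne, ← hH, hzp, hfeq, map_sub, map_mul, map_mul]
        calc algebraMap (blowupAlgebra 𝔓 (c 2)) L (blowupAlgebra.gen 𝔓 (c 2) (c p.1) (hc _))
            = (v * algebraMap (blowupAlgebra 𝔓 (c 2)) L (blowupAlgebra.gen 𝔓 (c 2) (c q.1) (hc _))) *
                algebraMap (blowupAlgebra 𝔓 (c 2)) L (blowupAlgebra.gen 𝔓 (c 2) (c p.1) (hc _)) := by rw [hv, one_mul]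
          _ = _ := by ring
      rw [key]
      exact Ideal.mul_mem_left _ _ (Ideal.add_mem _ (Ideal.subset_span ⟨_, rfl⟩)
        (Ideal.mul_mem_left _ _ (Ideal.mul_mem_right _ _ (Ideal.subset_span ⟨_, rfl⟩))))
    have hspan := chartsOverCentre_span_range_update_eq z _ _ hy hzmem
    refine ⟨1 + l + 1, Function.update z (Fin.castAdd l 0).succ (algebraMap (blowupAlgebra 𝔓 (c 2)) L (blowupAlgebra.gen 𝔓 (c 2) (c 0) (hc 0) * blowupAlgebra.gen 𝔓 (c 2) (c 1) (hc 1) - blowupAlgebra.gen 𝔓 (c 2) (c 2) (hc 2) * blowupAlgebra.gen 𝔓 (c 2) (c 3) (hc 3) * algebraMap R (blowupAlgebra 𝔓 (c 2)) (∏ k ∈ S, w k))), (Fin.castAdd l 0).succ, 0,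
      Fin.cons 2 (Fin.append ![0] fun k => if k ∈ T then 1 else 0), algebraMap (blowupAlgebra 𝔓 (c 2)) L (blowupAlgebra.gen 𝔓 (c 2) (c 3) (hc 3)), Fin.succ_ne_zero _,
      chartsOverCentre_isRsopPart_of_span_eq hrs hspan, Function.update_self _ _ _, ?_, rfl, ?_,
      fun i hi => ?_, hunit 3 h3, ?_⟩
    · rw [Function.update_of_ne (Fin.succ_ne_zero _).symm, hz0]
    · rw [Fin.cons_succ, Fin.append_left]
      rfl
    · obtain ⟨i, rfl⟩ := Fin.exists_succ_eq.mpr hi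
      rw [Fin.cons_succ]
      refine Fin.addCases (fun t => ?_) (fun k => ?_) i
      · rw [Fin.append_left]
        fin_cases t
        simp
      · rw [Fin.append_right]
        split_ifs <;> omega
    · rw [chartsOverCentre_prod_update_pow _ _ _ _ (by rw [Fin.cons_succ, Fin.append_left]; rfl), hzdef,
        chartsOverCentre_prod_chartFamily_pow, hbdry, Fin.prod_univ_one]
      simp only [jJ, Matrix.cons_val_zero, pow_zero, mul_one]
      rw [show algebraMap (blowupAlgebra 𝔓 (c 2)) L (algebraMap R (blowupAlgebra 𝔓 (c 2)) (c 2)) ^ 2 * algebraMap (blowupAlgebra 𝔓 (c 2)) L (blowupAlgebra.gen 𝔓 (c 2) (c 3) (hc 3)) * ∏ k ∈ T, algebraMap (blowupAlgebra 𝔓 (c 2)) L (algebraMap R (blowupAlgebra 𝔓 (c 2)) (w k)) -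
        algebraMap (blowupAlgebra 𝔓 (c 2)) L (blowupAlgebra.gen 𝔓 (c 2) (c 3) (hc 3)) * (algebraMap (blowupAlgebra 𝔓 (c 2)) L (algebraMap R (blowupAlgebra 𝔓 (c 2)) (c 2)) ^ 2 * ∏ k ∈ T, algebraMap (blowupAlgebra 𝔓 (c 2)) L (algebraMap R (blowupAlgebra 𝔓 (c 2)) (w k))) = 0 by ring]
      exact Ideal.zero_mem _

end Summit.ResolutionOfSingularities.ResolutionOfSingularities.Theorems

end
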